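import Summits.AtomisticToContinuum.Crystallization.Theorems.ChargedEnergyGapRotationRepair
import HarnessLib

/-!
(SPLIT FOR THE 400-LINE CAP by the landing lane, hand-2 g31: this file = part 1 of 2; sequels `…ChargedEnergyGapStressFreeCubic` import it in a chain; same namespace, all FQNs unchanged.)
# `ChargedEnergyGap` — the ROTATION GAUGE (3/3): a STRESS-FREE CUBIC LENNARD-JONES LATTICE — the satisfiability witness of the alarm
# (cell `decomp-a2c`, lens 3, generation 61, node «RotationGauge», part P-I(3/3); over part P-I(2/2) `…Theorems.ChargedEnergyGapRotationRepair`)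

CRITIC ROW 1109 (3)(d) M1 / PROTOCOL (V2).  The alarm `harmStableWith_nonpos` of part P-I(1/2) refutes the typed stability hypothesis on every
STRESS-FREE periodic reference with a bond of length `≤ 2`; this part exhibits such a reference IN THE KERNEL, so the alarm's hypothesis block
is SATISFIABLE and `HarmStableWith μ₀ P` is refuted on a CONCRETE `P` at every `μ₀ > 0` (`cubicRef_not_harmStableWith`,
`exists_forceFree_stressFree_not_harmStableWith`).

THE CONSTRUCTION.  `cubicRef a` = the simple cubic lattice `a·ℤ³` (basis `a·eᵢ`, `Submodule.span ℤ`; discreteness and `IsZLattice` from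
Mathlib's `ZSpan` instances) with the one-point motif `{0}`; its points are exactly the vectors `a·n`, `n ∈ ℤ³` (`exists_eq_vec`, via
`Module.Basis.mem_span_iff_repr_mem`), parametrised by ★ `vecEquiv : ℤ³ ∖ 0 ≃ points ∖ 0`.  The virial tensor of `a·ℤ³` is
`S_ij(a) = Σ_{n ≠ 0} F(a|n|)·(a nᵢ)(a nⱼ)`, `F(d) = V′(d)/d` (summable by the tree's `PeriodicConfiguration.summable_inv_pow_dist`, exponents `12`
and `6`): ★ off-diagonal entries vanish by the coordinate reflections (`S_offDiag`), diagonal entries coincide by the coordinate swaps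
(`S_diag_eq`), and the trace is ★ `Σᵢ S_ii(a) = −a⁻¹²·Z(12) + a⁻⁶·Z(6)` with the Epstein zeta values `Z(s) = Σ_{n ∈ ℤ³∖0} |n|⁻ˢ`
(`epsteinA`, `epsteinB`, both `> 0`, `Z(12) ≤ Z(6)`).  At the STRESS-FREE SPACING ★ `a₀ := (Z(12)/Z(6))^{1/6} ∈ (0, 1]` (`Real.rpow`) the trace
vanishes (`S_trace_a0`), hence ★★ every `S_ij(a₀) = 0` (`S_a0_eq_zero`) and ★★ `IsStressFree (cubicRef a₀)` (`isStressFree_cubic`, expanding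
`⟪z, u⟫⟪z, w⟫` in coordinates and exchanging `Σ'` with the finite sums); ★ `IsForceFree (cubicRef a)` at every `a` by inversion symmetry
(`isForceFree_cubic`); the bond `(0, a₀e₀)` has length `a₀ ≤ 1 ≤ 2`.  (Numerically `Z(6) ≈ 8.40`, `Z(12) ≈ 6.20`, `a₀ ≈ 0.951` — not used.)

WHAT THIS DOES NOT WITNESS.  The cubic lattice is not Barlow-labelled and (being a saddle of the LJ energy under shear) presumably not
`HarmStableModRot`-stable: the satisfiability of the FULL hypothesis block of (H𝄪ʳ) — `IsSeparatedRef ∧ IsLabelledRef ∧ IsForceFree ∧ IsStressFree ∧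
HarmStableModRot (1/100)` at a relaxed hcp/fcc reference — is the census ask STAB-61 (floating point) and the typed leaf (K-v) of part P-I(2/2)'s
header; by protocol (V2) the repaired tower carries the tag [hyps-unwitnessed: HarmStableModRot] until STAB-61 reports.

TAGS.  WITNESS (every theorem PROVED; `Classical.choice` only through Mathlib) · imports P-I(2/2) by its future tree name. -/

noncomputable section
open scoped Classical
open Literature.MathematicalPhysics.StatisticalMechanics
open Literature.Geometry.DiscreteGeometry
open Summit.AtomisticToContinuum.Crystallization.Theses.PricedLinkCensus
open Summit.AtomisticToContinuum.Crystallization.Theorems.ChargedEnergyGapNegative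

namespace Summit.AtomisticToContinuum.Crystallization.Theorems.ChargedEnergyGapChartDial

namespace Cubic

/-! ## The cubic lattice `a·ℤ³` with one-point motif `{0}` -/

section Cubic

/-- The basis `a·e₀, a·e₁, a·e₂`. -/
def cubicBasis (a : ℝ) (ha : 0 < a) : Module.Basis (Fin 3) ℝ E3 :=
  (EuclideanSpace.basisFun (Fin 3) ℝ).toBasis.isUnitSMul (w := fun _ => a) fun _ => isUnit_iff_ne_zero.mpr ha.ne'

/-- `cubicBasis_apply` (docstring added by the landing lane; see the module docstring). [formal bookkeeping] -/
theorem cubicBasis_apply (a : ℝ) (ha : 0 < a) (i : Fin 3) : cubicBasis a ha i = a • EuclideanSpace.single i 1 := by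
  simp [cubicBasis, Module.Basis.isUnitSMul_apply]

/-- The simple cubic periodic configuration with spacing `a`: lattice `a·ℤ³`, motif `{0}`. -/
def cubicRef (a : ℝ) (ha : 0 < a) : PeriodicConfiguration 3 where
  lattice := Submodule.span ℤ (Set.range (cubicBasis a ha))
  discrete := inferInstance
  isZLattice := inferInstance
  motif := {0}
  motif_nonempty := by simp
  eq_of_sub_mem := by
    intro x hx y hy _
    simp only [Finset.mem_singleton] at hx hy
    rw [hx, hy]

/-- `cubicRef_motif` (docstring added by the landing lane; see the module docstring). [formal bookkeeping] -/
theorem cubicRef_motif (a : ℝ) (ha : 0 < a) : (cubicRef a ha).motif = {0} := rfl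

/-- `cubicRef_lattice` (docstring added by the landing lane; see the module docstring). [formal bookkeeping] -/
theorem cubicRef_lattice (a : ℝ) (ha : 0 < a) : (cubicRef a ha).lattice = Submodule.span ℤ (Set.range (cubicBasis a ha)) := rfl

/-- `mem_points_iff` (docstring added by the landing lane; see the module docstring). [formal bookkeeping] -/
theorem mem_points_iff (a : ℝ) (ha : 0 < a) (z : E3) :
    z ∈ (cubicRef a ha).points ↔ z ∈ Submodule.span ℤ (Set.range (cubicBasis a ha)) := by
  constructor
  · rintro ⟨y, hy, g, hg, rfl⟩
    rw [cubicRef_motif, Finset.mem_singleton] at hy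
    rw [hy, zero_add]
    exact hg
  · intro hz
    exact ⟨0, by simp [cubicRef_motif], z, hz, by simp⟩

/-- The integer vector `n` scaled by `a`, as a point of `E3`. -/
def vec (a : ℝ) (n : Fin 3 → ℤ) : E3 := WithLp.toLp 2 fun k => (n k : ℝ) * a

/-- `vec_apply` (docstring added by the landing lane; see the module docstring). [formal bookkeeping] -/
@[simp] theorem vec_apply (a : ℝ) (n : Fin 3 → ℤ) (k : Fin 3) : vec a n k = (n k : ℝ) * a := rfl

/-- `vec_eq_sum` (docstring added by the landing lane; see the module docstring). [formal bookkeeping] -/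
theorem vec_eq_sum (a : ℝ) (ha : 0 < a) (n : Fin 3 → ℤ) : vec a n = ∑ i, (n i : ℤ) • cubicBasis a ha i := by
  ext k
  simp [cubicBasis_apply, vec_apply, Finset.sum_apply, Pi.single_apply, ← Int.cast_smul_eq_zsmul ℝ, smul_smul]

/-- `vec_mem_span` (docstring added by the landing lane; see the module docstring). [formal bookkeeping] -/
theorem vec_mem_span (a : ℝ) (ha : 0 < a) (n : Fin 3 → ℤ) : vec a n ∈ Submodule.span ℤ (Set.range (cubicBasis a ha)) := by
  rw [vec_eq_sum a ha]
  exact Submodule.sum_mem _ fun i _ => Submodule.smul_mem _ _ (Submodule.subset_span (Set.mem_range_self i))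

/-- `vec_mem_points` (docstring added by the landing lane; see the module docstring). [formal bookkeeping] -/
theorem vec_mem_points (a : ℝ) (ha : 0 < a) (n : Fin 3 → ℤ) : vec a n ∈ (cubicRef a ha).points :=
  (mem_points_iff a ha _).2 (vec_mem_span a ha n)

/-- Points of the cubic configuration have coordinates in `a·ℤ`. -/
theorem exists_eq_vec (a : ℝ) (ha : 0 < a) {z : E3} (hz : z ∈ (cubicRef a ha).points) : ∃ n : Fin 3 → ℤ, z = vec a n := by
  rw [mem_points_iff, Module.Basis.mem_span_iff_repr_mem] at hz
  choose m hm using hz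
  refine ⟨m, ?_⟩
  ext k
  have hk := hm k
  simp only [cubicBasis, Module.Basis.repr_isUnitSMul, OrthonormalBasis.coe_toBasis_repr_apply,
    EuclideanSpace.basisFun_repr, algebraMap_int_eq, eq_intCast] at hk
  rw [Units.smul_def, smul_eq_mul] at hk
  have hu : (((isUnit_iff_ne_zero.mpr ha.ne' : IsUnit a).unit⁻¹ : ℝˣ) : ℝ) = a⁻¹ := by
    rw [Units.val_inv_eq_inv_val, IsUnit.unit_spec]
  rw [hu] at hk
  rw [vec_apply, hk]
  field_simp

/-- `vec_injective` (docstring added by the landing lane; see the module docstring). [formal bookkeeping] -/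
theorem vec_injective (a : ℝ) (ha : 0 < a) : Function.Injective (vec a) := by
  intro n m h
  funext k
  have := congrArg (fun z : E3 => z k) h
  simp only [vec_apply] at this
  exact_mod_cast (mul_right_cancel₀ ha.ne' this)

/-- `vec_zero` (docstring added by the landing lane; see the module docstring). [formal bookkeeping] -/
theorem vec_zero (a : ℝ) : vec a 0 = 0 := by
  ext k; simp

/-- `vec_eq_zero_iff` (docstring added by the landing lane; see the module docstring). [formal bookkeeping] -/
theorem vec_eq_zero_iff (a : ℝ) (ha : 0 < a) (n : Fin 3 → ℤ) : vec a n = 0 ↔ n = 0 := by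
  constructor
  · intro h
    exact vec_injective a ha (h.trans (vec_zero a).symm)
  · rintro rfl; exact vec_zero a

/-- `ℤ³ ∖ {0}`. -/
abbrev N3 := {n : Fin 3 → ℤ // n ≠ 0}

/-- ★ The parametrisation `ℤ³ ∖ 0 ≃ (a·ℤ³) ∖ 0`. -/
def vecEquiv (a : ℝ) (ha : 0 < a) : N3 ≃ {z : E3 // z ∈ (cubicRef a ha).points ∧ z ≠ 0} where
  toFun n := ⟨vec a n.1, vec_mem_points a ha n.1, fun h => n.2 ((vec_eq_zero_iff a ha n.1).1 h)⟩
  invFun z := ⟨fun k => round (z.1 k / a), fun h => by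
    obtain ⟨n, hn⟩ := exists_eq_vec a ha z.2.1
    have : n = 0 := by
      funext k
      have := congrArg (fun f : Fin 3 → ℤ => f k) h
      simp only [hn, vec_apply, Pi.zero_apply] at this
      rwa [mul_div_cancel_right₀ _ ha.ne', round_intCast] at this
    exact z.2.2 (by rw [hn, this, vec_zero])⟩
  left_inv n := by
    apply Subtype.ext; funext k
    simp [mul_div_cancel_right₀ _ ha.ne', round_intCast]
  right_inv z := by
    obtain ⟨n, hn⟩ := exists_eq_vec a ha z.2.1
    apply Subtype.ext
    simp only [hn, vec_apply, mul_div_cancel_right₀ _ ha.ne', round_intCast]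

/-- `vecEquiv_apply` (docstring added by the landing lane; see the module docstring). [formal bookkeeping] -/
@[simp] theorem vecEquiv_apply (a : ℝ) (ha : 0 < a) (n : N3) :
    ((vecEquiv a ha n : {z : E3 // z ∈ (cubicRef a ha).points ∧ z ≠ 0}) : E3) = vec a n.1 := rfl

/-- The squared integer length. -/
def nsq (n : Fin 3 → ℤ) : ℝ := ∑ k, ((n k : ℝ)) ^ 2

/-- `nsq_nonneg` (docstring added by the landing lane; see the module docstring). [formal bookkeeping] -/
theorem nsq_nonneg (n : Fin 3 → ℤ) : 0 ≤ nsq n := Finset.sum_nonneg fun _ _ => sq_nonneg _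

/-- `one_le_nsq` (docstring added by the landing lane; see the module docstring). [formal bookkeeping] -/
theorem one_le_nsq (n : N3) : 1 ≤ nsq n.1 := by
  obtain ⟨k, hk⟩ : ∃ k, n.1 k ≠ 0 := by
    by_contra h
    push Not at h
    exact n.2 (funext h)
  have h1 : (1 : ℝ) ≤ ((n.1 k : ℝ)) ^ 2 := by
    have : (1 : ℤ) ≤ (n.1 k) ^ 2 := by
      have := Int.one_le_abs hk
      nlinarith [abs_nonneg (n.1 k), sq_abs (n.1 k)]
    exact_mod_cast this
  exact h1.trans (Finset.single_le_sum (f := fun k => ((n.1 k : ℝ)) ^ 2) (fun _ _ => sq_nonneg _) (Finset.mem_univ k))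

/-- `nsq_pos` (docstring added by the landing lane; see the module docstring). [formal bookkeeping] -/
theorem nsq_pos (n : N3) : 0 < nsq n.1 := lt_of_lt_of_le one_pos (one_le_nsq n)

/-- `norm_vec_sq` (docstring added by the landing lane; see the module docstring). [formal bookkeeping] -/
theorem norm_vec_sq (a : ℝ) (n : Fin 3 → ℤ) : ‖vec a n‖ ^ 2 = a ^ 2 * nsq n := by
  rw [EuclideanSpace.real_norm_sq_eq, nsq, Finset.mul_sum]
  refine Finset.sum_congr rfl fun k _ => ?_
  rw [vec_apply]; ring

/-- `norm_vec` (docstring added by the landing lane; see the module docstring). [formal bookkeeping] -/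
theorem norm_vec (a : ℝ) (ha : 0 < a) (n : Fin 3 → ℤ) : ‖vec a n‖ = a * Real.sqrt (nsq n) := by
  have h := norm_vec_sq a n
  have h2 : (a * Real.sqrt (nsq n)) ^ 2 = a ^ 2 * nsq n := by
    rw [mul_pow, Real.sq_sqrt (nsq_nonneg n)]
  nlinarith [norm_nonneg (vec a n), mul_nonneg ha.le (Real.sqrt_nonneg (nsq n)), sq_nonneg (‖vec a n‖ - a * Real.sqrt (nsq n)),
    sq_nonneg (‖vec a n‖ + a * Real.sqrt (nsq n))]

/-- `dist_zero_vec` (docstring added by the landing lane; see the module docstring). [formal bookkeeping] -/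
theorem dist_zero_vec (a : ℝ) (ha : 0 < a) (n : Fin 3 → ℤ) : dist (0 : E3) (vec a n) = a * Real.sqrt (nsq n) := by
  rw [dist_comm, dist_eq_norm, sub_zero, norm_vec a ha]

end Cubic

end Cubic

end Summit.AtomisticToContinuum.Crystallization.Theorems.ChargedEnergyGapChartDial

end
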